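import Summits.CriticalPhenomena.PercolationContinuityZ3.Theorems.PercNearOneGluingNoHeavyLowerTailSahiCTCLevelDuality
import Summits.CriticalPhenomena.PercolationContinuityZ3.Theorems.PercNearOneGluingNoHeavyLowerTailSahiCTCCoLevelTwoSplit
import Summits.CriticalPhenomena.PercolationContinuityZ3.Theorems.PercNearOneGluingNoHeavyLowerTailSahiCTCLadderTwo
import HarnessLib

/-!
# `NoHeavyLowerTail` (crux stmt-CriticalPhenomena-4575), P3 lane: CTC AT CO-LEVEL 2 FOR EVERY PAIR OF UP-SETS, AND KAHN C5 / SAHI C₃ FOR THE SLOT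
# "AT LEAST TWO OF k OPEN", EVERY k (memo g25; end of the gen-23/24/25 chain)

Support file (seat `prim-l12-p3`, gen 25, landed gen 42; `--supports stmt-CriticalPhenomena-4575`).  With the ladder form proved for every pair of 2-live up-sets
(`…SahiCTCLadderTwo.coeff_ladder_two_nonneg_PiP`), the split `M₂ = Π·T + e₂·R'` (`…SahiCTCCoLevelTwoSplit.coeff_Mtwo_nonneg_of_ladder`, `…SahiCTCRPrime`)
gives **`M₂(𝒳,𝒵) ∈ ℕ[s]` for EVERY pair of up-sets** (`coeff_Mtwo_nonneg`); the level duality (`…SahiCTCLevelDuality`, `t = 2`) turns this into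
**`Ñ_{k−2}(K_𝒳,K_𝒵) ∈ ℕ[r]` for every pair of up-sets of the pattern cube** (`coeff_Ngen_cx_nonneg_two`, `ev_Ngen_cx_nonneg_two`) = CTC_{k−2}(k) for every
`k`, i.e. exactly the hypothesis `hN` of `…SahiAtLeastTwoRowA.sahiE_three_nonneg_of_atLeastTwo_of_Ngen`; hence **`sahiE_three_nonneg_atLeastTwo`: Kahn's
C5 / Sahi's C₃ inequality `E₃(1_H, 1_U, 1_V) ≥ 0` for `H` = "at least two of the `k` block coordinates open", every `k ≥ 3`, every interior `p`, all
increasing `U, V`** — unconditional, standard axioms.  Nothing is asserted about the crux in general.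
-/

noncomputable section

open scoped Classical

namespace Summit.CriticalPhenomena.PercolationContinuityZ3.Theorems

namespace SahiCTCForms

open Finset MvPolynomial SahiCTCGenFun

variable {α : Type*} [DecidableEq α] [Fintype α]

/-- **`M₂(𝒳,𝒵) ∈ ℕ[s]` for EVERY pair of up-sets** (the co-level-2 master polynomial of memo g23/g24, in the eight-product form of
`…SahiCTCCoLevelTwoSplit` / `…SahiCTCLevelDuality.Mop 2`): ladder form of the all-live parts (`coeff_ladder_two_nonneg_PiP`) + `R' ≥ 0`. [this work] -/
theorem coeff_Mtwo_nonneg {𝒳 𝒵 : Finset (Finset α)} (h𝒳 : IsUpperSet (𝒳 : Set (Finset α))) (h𝒵 : IsUpperSet (𝒵 : Set (Finset α)))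
    (n : α →₀ ℕ) :
    0 ≤ ((gf (bySize (· = 2)) * gf univ.powerset) * (gf univ.powerset * gf ((𝒳 ∩ 𝒵).filter fun S => 2 ≤ #S))
    - (gf (bySize (· = 2)) * gf univ.powerset) * (gf (𝒳.filter fun S => 2 ≤ #S) * gf (𝒵.filter fun S => 2 ≤ #S))
    + (gf (bySize (· = 2)) * gf (bySize (· < 2))) * (gf univ.powerset * gf ((𝒳 ∩ 𝒵).filter fun S => 2 ≤ #S))
    - (gf (bySize (· = 2)) * gf (bySize (· < 2))) * (gf (𝒳.filter fun S => 2 ≤ #S) * gf (𝒵.filter fun S => 2 ≤ #S))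
    - (gf (bySize (2 ≤ ·)) * gf univ.powerset) * (gf (bySize (· < 2)) * gf ((𝒳 ∩ 𝒵).filter fun S => #S = 2))
    - (gf (bySize (· = 2)) * gf (bySize (· < 2))) * (gf (𝒳.filter fun S => 2 ≤ #S) * gf (𝒵.filter fun S => #S < 2))
    - (gf (bySize (· = 2)) * gf (bySize (· < 2))) * (gf (𝒳.filter fun S => #S < 2) * gf (𝒵.filter fun S => 2 ≤ #S))
    + (gf (bySize (· = 2)) * gf (bySize (2 ≤ ·))) * (gf (𝒳.filter fun S => #S < 2) * gf (𝒵.filter fun S => #S < 2)) :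
      MvPolynomial α ℤ).coeff n :=
  coeff_Mtwo_nonneg_of_ladder h𝒳 h𝒵 (fun m => coeff_ladder_two_nonneg_PiP (isUpperSet_filter_two_le h𝒳) (isUpperSet_filter_two_le h𝒵)
    (fun _ hS => (mem_filter.1 hS).2) (fun _ hS => (mem_filter.1 hS).2) m) n

end SahiCTCForms

namespace SahiAllButC

open Finset MvPolynomial
open SahiHittingSlot SahiTransportCert SahiAllButOne SahiAllButTwo SahiCTCForms SahiCTCGenFun SahiCTCWeightedLYM
open Literature.Combinatorics.Sahi2008
open Literature.Probability.Percolation (DeterminedBy)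
open Literature.Probability.Percolation.DecisionTree (ind)

variable {k : ℕ}

/-- **CTC at co-level 2 for every `k` and EVERY pair of up-sets**: `Ñ_{k−2}(K_𝒳,K_𝒵) ∈ ℕ[r]` (`2 ≤ k`). [this work] -/
theorem coeff_Ngen_cx_nonneg_two (hk : 2 ≤ k) {𝒳 𝒵 : Set (Set (Fin k))} (h𝒳 : IsUpperSet 𝒳) (h𝒵 : IsUpperSet 𝒵) :
    ∀ m, 0 ≤ (Ngen (k - 2) (cx 𝒳) (cx 𝒵)).coeff m := by
  refine coeff_Ngen_cx_nonneg_of_Mop hk fun n => ?_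
  unfold Mop atLeast below exact
  exact coeff_Mtwo_nonneg (isUpperSet_openFam h𝒳) (isUpperSet_openFam h𝒵) n

/-- The same at the odds vector of any interior parameter vector: the hypothesis `hN` of `…SahiAtLeastTwoRowA`, for every pair. [this work] -/
theorem ev_Ngen_cx_nonneg_two (hk : 2 ≤ k) {q : Fin k → unitInterval} (hq : ∀ i, 0 < (q i : ℝ) ∧ (q i : ℝ) < 1)
    {𝒳 𝒵 : Set (Set (Fin k))} (h𝒳 : IsUpperSet 𝒳) (h𝒵 : IsUpperSet 𝒵) : 0 ≤ ev q (Ngen (k - 2) (cx 𝒳) (cx 𝒵)) := by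
  refine ev_Ngen_cx_nonneg_of_Mop hk hq fun n => ?_
  unfold Mop atLeast below exact
  exact coeff_Mtwo_nonneg (isUpperSet_openFam h𝒳) (isUpperSet_openFam h𝒵) n

/-- **KAHN C5 / SAHI C₃ FOR THE SLOT "AT LEAST TWO OF k OPEN", EVERY k ≥ 3**: for i.i.d.-free Bernoulli product measure with interior parameters on the
block `e : Fin k ↪ ι`, `H` the event "at least two of the `k` block coordinates are open" and any increasing `U, V`:
`E₃(1_H, 1_U, 1_V) ≥ 0`.  Unconditional: the transport certificate `ρ_{k−2}` of `…SahiAtLeastTwoRowA` with its (TC) row now discharged for every pair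
by `ev_Ngen_cx_nonneg_two`. [this work] -/
theorem sahiE_three_nonneg_atLeastTwo {ι : Type} [Fintype ι] (p : ι → unitInterval) (e : Fin k ↪ ι) (hk : 3 ≤ k)
    (hp : ∀ i, 0 < (p (e i) : ℝ) ∧ (p (e i) : ℝ) < 1)
    {H : Set (Set ι)} (hH : DeterminedBy H (Set.range e)) (hpat : pat e H = allBut (k - 2) k) {U V : Set (Set ι)} (hU : IsUpperSet U)
    (hV : IsUpperSet V) : 0 ≤ sahiE (bernoulliWeight p) 3 ![ind H, ind U, ind V] :=
  sahiE_three_nonneg_of_atLeastTwo_of_Ngen p e hk hp (fun 𝒳 𝒵 h𝒳 h𝒵 _ _ => ev_Ngen_cx_nonneg_two (by omega) hp h𝒳 h𝒵) hH hpat hU hV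

end SahiAllButC

end Summit.CriticalPhenomena.PercolationContinuityZ3.Theorems

end
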